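import Mathlib.Tactic.Ring
import Mathlib.Tactic.Linarith
import Mathlib.Tactic.Positivity
import Mathlib.Data.Real.Basic
import HarnessLib

/-!
# Conjecture N (hodge-weil ladder, GAPS G51b), THE VERTEX FORM of `G₀` in format (4,2): `S_u ≤ 0 ⇒ G₀ ≥ 0` without purity

Prover 2, generation 12 (note `run/shared/lean/b2b/hodge-weil/b2b-hweil-pv2-g12/VERTEX-FORM-G12.md`). Second file (mass 2) of the vertex form; the first, `WeilClassTestVertexForm.lean`, treats the mass-1
cluster. Companion of `WeilClassTestClusterLemmas.lean` / `WeilClassTestEscapeDirections.lean` (generation 11). Setting (`CONJECTURE-N.md` §1, real charges):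
a signed configuration of roots `k` with signs `ε_k = +1` (E) / `−1` (F), positions `y_k`, charges `u_k`; signed mass `m = Σε`
(`m = 2` for the class test in format `(f+2, f)`, `m = 1` for the five-root cluster of generation 11); centred coordinates
`Y_k = y_k − yb`, `Z_k = u_k − ub` with the signed means `yb = (Σεy)/m`, `ub = (Σεu)/m`; `S_y = ΣεY²`, `S_ζ = ΣεZ²`, `S_{yζ} = ΣεYZ`,
`S_{y²ζ²} = ΣεY²Z²`, `S_{ζ⁴} = ΣεZ⁴`; `Q₂ = ½S_yS_ζ + S_{yζ}² − 3S_{y²ζ²}`, `Q₄ = 3S_{ζ⁴} − (3/2)S_ζ²`, `G₀ = Q₂ + Q₄`.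

THE VERTEX FORM (new). For ANY reference point `V = (yV, uV)` put `p_k = ε_k((y_k + u_k) − (yV + uV))`, `q_k = ε_k((y_k − u_k) − (yV − uV))`
(light-cone 'corner coordinates'). Then, as a polynomial identity,
  `G₀ = 2 Σ_{k,l} H_kl q_k p_l`, `H_kl = ½Z_kZ_l + (3/2m)(Z_k² + Z_l²) + (1/4m + 3/2m²)·D` (`k ≠ l`), `D := −S_ζ`,
  `H_kk = 2Z_k² + (3/2)D` (E) / `5Z_k² + 2D` (F) for `m = 1`;  `H_kk = ½Z_k² + ¼D` (E) / `(7/2)Z_k² + ¾D` (F) for `m = 2`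
(the vector `ε` is in the kernel of `H`, which is why `V` is arbitrary). A configuration is DOMINANT AND PAIRWISE AMPLE
(`y_e − y_f ≥ |u_e − u_f|` for all `e ∈ E`, `f ∈ F`) iff some `V` has all `p_k, q_k ≥ 0` (E-roots in the future light cone of `V`, F-roots in
its past cone; e.g. `V =` the componentwise light-cone maximum of the F-roots). Since `(3/2m)(a² + b²) + ½ab ≥ 0`, every `H_kl ≥ 0` as soon as
`D ≥ 0`, i.e. `S_ζ ≤ 0`. CONSEQUENCES: (1) CONJECTURE K of generation 11 (`CROSS-MAX-G11.md` A1.3: every centred dominant ample (3,2)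
cluster with `S_ζ ≤ 0` has `G₀(C) ≥ 0`) — `cluster_G0_nonneg` (vertex form) and `cluster_G0_nonneg_frame` (literally in the frame
coordinates of `WeilClassTestClusterLemmas`); (2) in format (4,2) — mass 2, the class test itself — every dominant pairwise-ample
configuration with `S_u ≤ 0` has `G₀ ≥ 0` WITHOUT ANY PURITY HYPOTHESIS (`format42_G0_nonneg_of_Su_nonpos`); Conjecture N in format
(4,2) is thereby reduced to the charge region `S_u > 0`. Pure algebra (`ring`) plus products of non-negative reals; nothing here is a
rung, a door edge or a cited fact; no statement of Markman's papers is used. New cell result ⇒ Summits/.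
-/

set_option linter.dupNamespace false

namespace Summit.HodgeConjecture.HodgeConjecture.WeilClassTestVertexForm42

/-- VERTEX FORM, mass 2 (format (4,2) of the class test: E-roots `1..4`, F-roots `5,6`): `G₀ = 2Σ_{k,l} H_kl q_k p_l` for an arbitrary
reference point `(yV, uV)` — a polynomial identity (`ring`). No purity is assumed. -/
theorem format42_G0_vertex_identity (y₁ y₂ y₃ y₄ y₅ y₆ u₁ u₂ u₃ u₄ u₅ u₆ yV uV : ℝ) :
    let yb : ℝ := (y₁ + y₂ + y₃ + y₄ - y₅ - y₆) / 2
    let ub : ℝ := (u₁ + u₂ + u₃ + u₄ - u₅ - u₆) / 2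
    let Y₁ : ℝ := y₁ - yb
    let Y₂ : ℝ := y₂ - yb
    let Y₃ : ℝ := y₃ - yb
    let Y₄ : ℝ := y₄ - yb
    let Y₅ : ℝ := y₅ - yb
    let Y₆ : ℝ := y₆ - yb
    let Z₁ : ℝ := u₁ - ub
    let Z₂ : ℝ := u₂ - ub
    let Z₃ : ℝ := u₃ - ub
    let Z₄ : ℝ := u₄ - ub
    let Z₅ : ℝ := u₅ - ub
    let Z₆ : ℝ := u₆ - ub
    let Sy : ℝ := Y₁ ^ 2 + Y₂ ^ 2 + Y₃ ^ 2 + Y₄ ^ 2 - (Y₅ ^ 2 + Y₆ ^ 2)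
    let Sz : ℝ := Z₁ ^ 2 + Z₂ ^ 2 + Z₃ ^ 2 + Z₄ ^ 2 - (Z₅ ^ 2 + Z₆ ^ 2)
    let Syz : ℝ := Y₁ * Z₁ + Y₂ * Z₂ + Y₃ * Z₃ + Y₄ * Z₄ - (Y₅ * Z₅ + Y₆ * Z₆)
    let Sy2z2 : ℝ := Y₁ ^ 2 * Z₁ ^ 2 + Y₂ ^ 2 * Z₂ ^ 2 + Y₃ ^ 2 * Z₃ ^ 2 + Y₄ ^ 2 * Z₄ ^ 2 - (Y₅ ^ 2 * Z₅ ^ 2 + Y₆ ^ 2 * Z₆ ^ 2)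
    let Sz4 : ℝ := Z₁ ^ 4 + Z₂ ^ 4 + Z₃ ^ 4 + Z₄ ^ 4 - (Z₅ ^ 4 + Z₆ ^ 4)
    let D : ℝ := -Sz
    let p₁ : ℝ := (y₁ + u₁) - (yV + uV)
    let q₁ : ℝ := (y₁ - u₁) - (yV - uV)
    let p₂ : ℝ := (y₂ + u₂) - (yV + uV)
    let q₂ : ℝ := (y₂ - u₂) - (yV - uV)
    let p₃ : ℝ := (y₃ + u₃) - (yV + uV)
    let q₃ : ℝ := (y₃ - u₃) - (yV - uV)
    let p₄ : ℝ := (y₄ + u₄) - (yV + uV)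
    let q₄ : ℝ := (y₄ - u₄) - (yV - uV)
    let p₅ : ℝ := (yV + uV) - (y₅ + u₅)
    let q₅ : ℝ := (yV - uV) - (y₅ - u₅)
    let p₆ : ℝ := (yV + uV) - (y₆ + u₆)
    let q₆ : ℝ := (yV - uV) - (y₆ - u₆)
    1 / 2 * Sy * Sz + Syz ^ 2 - 3 * Sy2z2 + (3 * Sz4 - 3 / 2 * Sz ^ 2)
      = 2 * ((1/2 * Z₁ ^ 2 + 1/4 * D) * (q₁ * p₁)
        + (1/2 * Z₁ * Z₂ + 3/4 * (Z₁ ^ 2 + Z₂ ^ 2) + 1/2 * D) * (q₁ * p₂ + q₂ * p₁)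
        + (1/2 * Z₁ * Z₃ + 3/4 * (Z₁ ^ 2 + Z₃ ^ 2) + 1/2 * D) * (q₁ * p₃ + q₃ * p₁)
        + (1/2 * Z₁ * Z₄ + 3/4 * (Z₁ ^ 2 + Z₄ ^ 2) + 1/2 * D) * (q₁ * p₄ + q₄ * p₁)
        + (1/2 * Z₁ * Z₅ + 3/4 * (Z₁ ^ 2 + Z₅ ^ 2) + 1/2 * D) * (q₁ * p₅ + q₅ * p₁)
        + (1/2 * Z₁ * Z₆ + 3/4 * (Z₁ ^ 2 + Z₆ ^ 2) + 1/2 * D) * (q₁ * p₆ + q₆ * p₁)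
        + (1/2 * Z₂ ^ 2 + 1/4 * D) * (q₂ * p₂)
        + (1/2 * Z₂ * Z₃ + 3/4 * (Z₂ ^ 2 + Z₃ ^ 2) + 1/2 * D) * (q₂ * p₃ + q₃ * p₂)
        + (1/2 * Z₂ * Z₄ + 3/4 * (Z₂ ^ 2 + Z₄ ^ 2) + 1/2 * D) * (q₂ * p₄ + q₄ * p₂)
        + (1/2 * Z₂ * Z₅ + 3/4 * (Z₂ ^ 2 + Z₅ ^ 2) + 1/2 * D) * (q₂ * p₅ + q₅ * p₂)
        + (1/2 * Z₂ * Z₆ + 3/4 * (Z₂ ^ 2 + Z₆ ^ 2) + 1/2 * D) * (q₂ * p₆ + q₆ * p₂)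
        + (1/2 * Z₃ ^ 2 + 1/4 * D) * (q₃ * p₃)
        + (1/2 * Z₃ * Z₄ + 3/4 * (Z₃ ^ 2 + Z₄ ^ 2) + 1/2 * D) * (q₃ * p₄ + q₄ * p₃)
        + (1/2 * Z₃ * Z₅ + 3/4 * (Z₃ ^ 2 + Z₅ ^ 2) + 1/2 * D) * (q₃ * p₅ + q₅ * p₃)
        + (1/2 * Z₃ * Z₆ + 3/4 * (Z₃ ^ 2 + Z₆ ^ 2) + 1/2 * D) * (q₃ * p₆ + q₆ * p₃)
        + (1/2 * Z₄ ^ 2 + 1/4 * D) * (q₄ * p₄)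
        + (1/2 * Z₄ * Z₅ + 3/4 * (Z₄ ^ 2 + Z₅ ^ 2) + 1/2 * D) * (q₄ * p₅ + q₅ * p₄)
        + (1/2 * Z₄ * Z₆ + 3/4 * (Z₄ ^ 2 + Z₆ ^ 2) + 1/2 * D) * (q₄ * p₆ + q₆ * p₄)
        + (7/2 * Z₅ ^ 2 + 3/4 * D) * (q₅ * p₅)
        + (1/2 * Z₅ * Z₆ + 3/4 * (Z₅ ^ 2 + Z₆ ^ 2) + 1/2 * D) * (q₅ * p₆ + q₆ * p₅)
        + (7/2 * Z₆ ^ 2 + 3/4 * D) * (q₆ * p₆)) := by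
  intro yb ub Y₁ Y₂ Y₃ Y₄ Y₅ Y₆ Z₁ Z₂ Z₃ Z₄ Z₅ Z₆ Sy Sz Syz Sy2z2 Sz4 D p₁ q₁ p₂ q₂ p₃ q₃ p₄ q₄ p₅ q₅ p₆ q₆
  simp only [q₆, p₆, q₅, p₅, q₄, p₄, q₃, p₃, q₂, p₂, q₁, p₁, D, Sz4, Sy2z2, Syz, Sz, Sy, Z₆, Z₅, Z₄, Z₃, Z₂, Z₁, Y₆, Y₅, Y₄, Y₃, Y₂, Y₁, ub, yb]
  ring

/-- Every summand of the mass-2 vertex form is non-negative once `D ≥ 0` and all corner coordinates are `≥ 0`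
(`¾(a² + b²) + ½ab = ½(a² + b²) + ¼(a + b)² ≥ 0`). Plain real variables. -/
theorem format42_vertexSum_nonneg (Z₁ Z₂ Z₃ Z₄ Z₅ Z₆ D p₁ q₁ p₂ q₂ p₃ q₃ p₄ q₄ p₅ q₅ p₆ q₆ : ℝ)
    (hD : 0 ≤ D)
    (gp₁ : 0 ≤ p₁) (gq₁ : 0 ≤ q₁) (gp₂ : 0 ≤ p₂) (gq₂ : 0 ≤ q₂) (gp₃ : 0 ≤ p₃) (gq₃ : 0 ≤ q₃) (gp₄ : 0 ≤ p₄) (gq₄ : 0 ≤ q₄) (gp₅ : 0 ≤ p₅) (gq₅ : 0 ≤ q₅) (gp₆ : 0 ≤ p₆) (gq₆ : 0 ≤ q₆) :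
    0 ≤ 2 * ((1/2 * Z₁ ^ 2 + 1/4 * D) * (q₁ * p₁)
        + (1/2 * Z₁ * Z₂ + 3/4 * (Z₁ ^ 2 + Z₂ ^ 2) + 1/2 * D) * (q₁ * p₂ + q₂ * p₁)
        + (1/2 * Z₁ * Z₃ + 3/4 * (Z₁ ^ 2 + Z₃ ^ 2) + 1/2 * D) * (q₁ * p₃ + q₃ * p₁)
        + (1/2 * Z₁ * Z₄ + 3/4 * (Z₁ ^ 2 + Z₄ ^ 2) + 1/2 * D) * (q₁ * p₄ + q₄ * p₁)
        + (1/2 * Z₁ * Z₅ + 3/4 * (Z₁ ^ 2 + Z₅ ^ 2) + 1/2 * D) * (q₁ * p₅ + q₅ * p₁)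
        + (1/2 * Z₁ * Z₆ + 3/4 * (Z₁ ^ 2 + Z₆ ^ 2) + 1/2 * D) * (q₁ * p₆ + q₆ * p₁)
        + (1/2 * Z₂ ^ 2 + 1/4 * D) * (q₂ * p₂)
        + (1/2 * Z₂ * Z₃ + 3/4 * (Z₂ ^ 2 + Z₃ ^ 2) + 1/2 * D) * (q₂ * p₃ + q₃ * p₂)
        + (1/2 * Z₂ * Z₄ + 3/4 * (Z₂ ^ 2 + Z₄ ^ 2) + 1/2 * D) * (q₂ * p₄ + q₄ * p₂)
        + (1/2 * Z₂ * Z₅ + 3/4 * (Z₂ ^ 2 + Z₅ ^ 2) + 1/2 * D) * (q₂ * p₅ + q₅ * p₂)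
        + (1/2 * Z₂ * Z₆ + 3/4 * (Z₂ ^ 2 + Z₆ ^ 2) + 1/2 * D) * (q₂ * p₆ + q₆ * p₂)
        + (1/2 * Z₃ ^ 2 + 1/4 * D) * (q₃ * p₃)
        + (1/2 * Z₃ * Z₄ + 3/4 * (Z₃ ^ 2 + Z₄ ^ 2) + 1/2 * D) * (q₃ * p₄ + q₄ * p₃)
        + (1/2 * Z₃ * Z₅ + 3/4 * (Z₃ ^ 2 + Z₅ ^ 2) + 1/2 * D) * (q₃ * p₅ + q₅ * p₃)
        + (1/2 * Z₃ * Z₆ + 3/4 * (Z₃ ^ 2 + Z₆ ^ 2) + 1/2 * D) * (q₃ * p₆ + q₆ * p₃)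
        + (1/2 * Z₄ ^ 2 + 1/4 * D) * (q₄ * p₄)
        + (1/2 * Z₄ * Z₅ + 3/4 * (Z₄ ^ 2 + Z₅ ^ 2) + 1/2 * D) * (q₄ * p₅ + q₅ * p₄)
        + (1/2 * Z₄ * Z₆ + 3/4 * (Z₄ ^ 2 + Z₆ ^ 2) + 1/2 * D) * (q₄ * p₆ + q₆ * p₄)
        + (7/2 * Z₅ ^ 2 + 3/4 * D) * (q₅ * p₅)
        + (1/2 * Z₅ * Z₆ + 3/4 * (Z₅ ^ 2 + Z₆ ^ 2) + 1/2 * D) * (q₅ * p₆ + q₆ * p₅)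
        + (7/2 * Z₆ ^ 2 + 3/4 * D) * (q₆ * p₆)) := by
  have t11 : 0 ≤ (1/2 * Z₁ ^ 2 + 1/4 * D) * (q₁ * p₁) :=
    mul_nonneg (by linarith [sq_nonneg Z₁, hD]) (mul_nonneg gq₁ gp₁)
  have t12 : 0 ≤ (1/2 * Z₁ * Z₂ + 3/4 * (Z₁ ^ 2 + Z₂ ^ 2) + 1/2 * D) * (q₁ * p₂ + q₂ * p₁) :=
    mul_nonneg (by linarith [sq_nonneg (Z₁ + Z₂), sq_nonneg Z₁, sq_nonneg Z₂, hD])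
      (add_nonneg (mul_nonneg gq₁ gp₂) (mul_nonneg gq₂ gp₁))
  have t13 : 0 ≤ (1/2 * Z₁ * Z₃ + 3/4 * (Z₁ ^ 2 + Z₃ ^ 2) + 1/2 * D) * (q₁ * p₃ + q₃ * p₁) :=
    mul_nonneg (by linarith [sq_nonneg (Z₁ + Z₃), sq_nonneg Z₁, sq_nonneg Z₃, hD])
      (add_nonneg (mul_nonneg gq₁ gp₃) (mul_nonneg gq₃ gp₁))
  have t14 : 0 ≤ (1/2 * Z₁ * Z₄ + 3/4 * (Z₁ ^ 2 + Z₄ ^ 2) + 1/2 * D) * (q₁ * p₄ + q₄ * p₁) :=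
    mul_nonneg (by linarith [sq_nonneg (Z₁ + Z₄), sq_nonneg Z₁, sq_nonneg Z₄, hD])
      (add_nonneg (mul_nonneg gq₁ gp₄) (mul_nonneg gq₄ gp₁))
  have t15 : 0 ≤ (1/2 * Z₁ * Z₅ + 3/4 * (Z₁ ^ 2 + Z₅ ^ 2) + 1/2 * D) * (q₁ * p₅ + q₅ * p₁) :=
    mul_nonneg (by linarith [sq_nonneg (Z₁ + Z₅), sq_nonneg Z₁, sq_nonneg Z₅, hD])
      (add_nonneg (mul_nonneg gq₁ gp₅) (mul_nonneg gq₅ gp₁))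
  have t16 : 0 ≤ (1/2 * Z₁ * Z₆ + 3/4 * (Z₁ ^ 2 + Z₆ ^ 2) + 1/2 * D) * (q₁ * p₆ + q₆ * p₁) :=
    mul_nonneg (by linarith [sq_nonneg (Z₁ + Z₆), sq_nonneg Z₁, sq_nonneg Z₆, hD])
      (add_nonneg (mul_nonneg gq₁ gp₆) (mul_nonneg gq₆ gp₁))
  have t22 : 0 ≤ (1/2 * Z₂ ^ 2 + 1/4 * D) * (q₂ * p₂) :=
    mul_nonneg (by linarith [sq_nonneg Z₂, hD]) (mul_nonneg gq₂ gp₂)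
  have t23 : 0 ≤ (1/2 * Z₂ * Z₃ + 3/4 * (Z₂ ^ 2 + Z₃ ^ 2) + 1/2 * D) * (q₂ * p₃ + q₃ * p₂) :=
    mul_nonneg (by linarith [sq_nonneg (Z₂ + Z₃), sq_nonneg Z₂, sq_nonneg Z₃, hD])
      (add_nonneg (mul_nonneg gq₂ gp₃) (mul_nonneg gq₃ gp₂))
  have t24 : 0 ≤ (1/2 * Z₂ * Z₄ + 3/4 * (Z₂ ^ 2 + Z₄ ^ 2) + 1/2 * D) * (q₂ * p₄ + q₄ * p₂) :=
    mul_nonneg (by linarith [sq_nonneg (Z₂ + Z₄), sq_nonneg Z₂, sq_nonneg Z₄, hD])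
      (add_nonneg (mul_nonneg gq₂ gp₄) (mul_nonneg gq₄ gp₂))
  have t25 : 0 ≤ (1/2 * Z₂ * Z₅ + 3/4 * (Z₂ ^ 2 + Z₅ ^ 2) + 1/2 * D) * (q₂ * p₅ + q₅ * p₂) :=
    mul_nonneg (by linarith [sq_nonneg (Z₂ + Z₅), sq_nonneg Z₂, sq_nonneg Z₅, hD])
      (add_nonneg (mul_nonneg gq₂ gp₅) (mul_nonneg gq₅ gp₂))
  have t26 : 0 ≤ (1/2 * Z₂ * Z₆ + 3/4 * (Z₂ ^ 2 + Z₆ ^ 2) + 1/2 * D) * (q₂ * p₆ + q₆ * p₂) :=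
    mul_nonneg (by linarith [sq_nonneg (Z₂ + Z₆), sq_nonneg Z₂, sq_nonneg Z₆, hD])
      (add_nonneg (mul_nonneg gq₂ gp₆) (mul_nonneg gq₆ gp₂))
  have t33 : 0 ≤ (1/2 * Z₃ ^ 2 + 1/4 * D) * (q₃ * p₃) :=
    mul_nonneg (by linarith [sq_nonneg Z₃, hD]) (mul_nonneg gq₃ gp₃)
  have t34 : 0 ≤ (1/2 * Z₃ * Z₄ + 3/4 * (Z₃ ^ 2 + Z₄ ^ 2) + 1/2 * D) * (q₃ * p₄ + q₄ * p₃) :=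
    mul_nonneg (by linarith [sq_nonneg (Z₃ + Z₄), sq_nonneg Z₃, sq_nonneg Z₄, hD])
      (add_nonneg (mul_nonneg gq₃ gp₄) (mul_nonneg gq₄ gp₃))
  have t35 : 0 ≤ (1/2 * Z₃ * Z₅ + 3/4 * (Z₃ ^ 2 + Z₅ ^ 2) + 1/2 * D) * (q₃ * p₅ + q₅ * p₃) :=
    mul_nonneg (by linarith [sq_nonneg (Z₃ + Z₅), sq_nonneg Z₃, sq_nonneg Z₅, hD])
      (add_nonneg (mul_nonneg gq₃ gp₅) (mul_nonneg gq₅ gp₃))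
  have t36 : 0 ≤ (1/2 * Z₃ * Z₆ + 3/4 * (Z₃ ^ 2 + Z₆ ^ 2) + 1/2 * D) * (q₃ * p₆ + q₆ * p₃) :=
    mul_nonneg (by linarith [sq_nonneg (Z₃ + Z₆), sq_nonneg Z₃, sq_nonneg Z₆, hD])
      (add_nonneg (mul_nonneg gq₃ gp₆) (mul_nonneg gq₆ gp₃))
  have t44 : 0 ≤ (1/2 * Z₄ ^ 2 + 1/4 * D) * (q₄ * p₄) :=
    mul_nonneg (by linarith [sq_nonneg Z₄, hD]) (mul_nonneg gq₄ gp₄)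
  have t45 : 0 ≤ (1/2 * Z₄ * Z₅ + 3/4 * (Z₄ ^ 2 + Z₅ ^ 2) + 1/2 * D) * (q₄ * p₅ + q₅ * p₄) :=
    mul_nonneg (by linarith [sq_nonneg (Z₄ + Z₅), sq_nonneg Z₄, sq_nonneg Z₅, hD])
      (add_nonneg (mul_nonneg gq₄ gp₅) (mul_nonneg gq₅ gp₄))
  have t46 : 0 ≤ (1/2 * Z₄ * Z₆ + 3/4 * (Z₄ ^ 2 + Z₆ ^ 2) + 1/2 * D) * (q₄ * p₆ + q₆ * p₄) :=
    mul_nonneg (by linarith [sq_nonneg (Z₄ + Z₆), sq_nonneg Z₄, sq_nonneg Z₆, hD])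
      (add_nonneg (mul_nonneg gq₄ gp₆) (mul_nonneg gq₆ gp₄))
  have t55 : 0 ≤ (7/2 * Z₅ ^ 2 + 3/4 * D) * (q₅ * p₅) :=
    mul_nonneg (by linarith [sq_nonneg Z₅, hD]) (mul_nonneg gq₅ gp₅)
  have t56 : 0 ≤ (1/2 * Z₅ * Z₆ + 3/4 * (Z₅ ^ 2 + Z₆ ^ 2) + 1/2 * D) * (q₅ * p₆ + q₆ * p₅) :=
    mul_nonneg (by linarith [sq_nonneg (Z₅ + Z₆), sq_nonneg Z₅, sq_nonneg Z₆, hD])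
      (add_nonneg (mul_nonneg gq₅ gp₆) (mul_nonneg gq₆ gp₅))
  have t66 : 0 ≤ (7/2 * Z₆ ^ 2 + 3/4 * D) * (q₆ * p₆) :=
    mul_nonneg (by linarith [sq_nonneg Z₆, hD]) (mul_nonneg gq₆ gp₆)
  exact mul_nonneg (by norm_num) (add_nonneg (add_nonneg (add_nonneg (add_nonneg (add_nonneg (add_nonneg (add_nonneg (add_nonneg (add_nonneg (add_nonneg (add_nonneg (add_nonneg (add_nonneg (add_nonneg (add_nonneg (add_nonneg (add_nonneg (add_nonneg (add_nonneg (add_nonneg t11 t12) t13) t14) t15) t16) t22) t23) t24) t25) t26) t33) t34) t35) t36) t44) t45) t46) t55) t56) t66)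

/-- Format (4,2), NO PURITY: a dominant pairwise-ample configuration (E-roots in the future light cone of some `V`, F-roots in its past
cone) whose centred charges satisfy `S_u = ΣεZ² ≤ 0` has `G₀ = Q₂ + Q₄ ≥ 0`. (So Conjecture N in format (4,2) only concerns `S_u > 0`.) -/
theorem format42_G0_nonneg_of_Su_nonpos (y₁ y₂ y₃ y₄ y₅ y₆ u₁ u₂ u₃ u₄ u₅ u₆ yV uV : ℝ)
    (hp₁ : u₁ - uV ≤ y₁ - yV) (hq₁ : uV - u₁ ≤ y₁ - yV)
    (hp₂ : u₂ - uV ≤ y₂ - yV) (hq₂ : uV - u₂ ≤ y₂ - yV)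
    (hp₃ : u₃ - uV ≤ y₃ - yV) (hq₃ : uV - u₃ ≤ y₃ - yV)
    (hp₄ : u₄ - uV ≤ y₄ - yV) (hq₄ : uV - u₄ ≤ y₄ - yV)
    (hp₅ : u₅ - uV ≤ yV - y₅) (hq₅ : uV - u₅ ≤ yV - y₅)
    (hp₆ : u₆ - uV ≤ yV - y₆) (hq₆ : uV - u₆ ≤ yV - y₆) :
    let yb : ℝ := (y₁ + y₂ + y₃ + y₄ - y₅ - y₆) / 2
    let ub : ℝ := (u₁ + u₂ + u₃ + u₄ - u₅ - u₆) / 2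
    let Y₁ : ℝ := y₁ - yb
    let Y₂ : ℝ := y₂ - yb
    let Y₃ : ℝ := y₃ - yb
    let Y₄ : ℝ := y₄ - yb
    let Y₅ : ℝ := y₅ - yb
    let Y₆ : ℝ := y₆ - yb
    let Z₁ : ℝ := u₁ - ub
    let Z₂ : ℝ := u₂ - ub
    let Z₃ : ℝ := u₃ - ub
    let Z₄ : ℝ := u₄ - ub
    let Z₅ : ℝ := u₅ - ub
    let Z₆ : ℝ := u₆ - ub
    let Sy : ℝ := Y₁ ^ 2 + Y₂ ^ 2 + Y₃ ^ 2 + Y₄ ^ 2 - (Y₅ ^ 2 + Y₆ ^ 2)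
    let Sz : ℝ := Z₁ ^ 2 + Z₂ ^ 2 + Z₃ ^ 2 + Z₄ ^ 2 - (Z₅ ^ 2 + Z₆ ^ 2)
    let Syz : ℝ := Y₁ * Z₁ + Y₂ * Z₂ + Y₃ * Z₃ + Y₄ * Z₄ - (Y₅ * Z₅ + Y₆ * Z₆)
    let Sy2z2 : ℝ := Y₁ ^ 2 * Z₁ ^ 2 + Y₂ ^ 2 * Z₂ ^ 2 + Y₃ ^ 2 * Z₃ ^ 2 + Y₄ ^ 2 * Z₄ ^ 2 - (Y₅ ^ 2 * Z₅ ^ 2 + Y₆ ^ 2 * Z₆ ^ 2)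
    let Sz4 : ℝ := Z₁ ^ 4 + Z₂ ^ 4 + Z₃ ^ 4 + Z₄ ^ 4 - (Z₅ ^ 4 + Z₆ ^ 4)
    Sz ≤ 0 → 0 ≤ 1 / 2 * Sy * Sz + Syz ^ 2 - 3 * Sy2z2 + (3 * Sz4 - 3 / 2 * Sz ^ 2) := by
  intro yb ub Y₁ Y₂ Y₃ Y₄ Y₅ Y₆ Z₁ Z₂ Z₃ Z₄ Z₅ Z₆ Sy Sz Syz Sy2z2 Sz4 hS
  have hD : 0 ≤ (-Sz) := by linarith
  have gp₁ : 0 ≤ ((y₁ + u₁) - (yV + uV)) := by linarith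
  have gq₁ : 0 ≤ ((y₁ - u₁) - (yV - uV)) := by linarith
  have gp₂ : 0 ≤ ((y₂ + u₂) - (yV + uV)) := by linarith
  have gq₂ : 0 ≤ ((y₂ - u₂) - (yV - uV)) := by linarith
  have gp₃ : 0 ≤ ((y₃ + u₃) - (yV + uV)) := by linarith
  have gq₃ : 0 ≤ ((y₃ - u₃) - (yV - uV)) := by linarith
  have gp₄ : 0 ≤ ((y₄ + u₄) - (yV + uV)) := by linarith
  have gq₄ : 0 ≤ ((y₄ - u₄) - (yV - uV)) := by linarith
  have gp₅ : 0 ≤ ((yV + uV) - (y₅ + u₅)) := by linarith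
  have gq₅ : 0 ≤ ((yV - uV) - (y₅ - u₅)) := by linarith
  have gp₆ : 0 ≤ ((yV + uV) - (y₆ + u₆)) := by linarith
  have gq₆ : 0 ≤ ((yV - uV) - (y₆ - u₆)) := by linarith
  have key : 1 / 2 * Sy * Sz + Syz ^ 2 - 3 * Sy2z2 + (3 * Sz4 - 3 / 2 * Sz ^ 2)
      = 2 * ((1/2 * Z₁ ^ 2 + 1/4 * (-Sz)) * (((y₁ - u₁) - (yV - uV)) * ((y₁ + u₁) - (yV + uV)))
        + (1/2 * Z₁ * Z₂ + 3/4 * (Z₁ ^ 2 + Z₂ ^ 2) + 1/2 * (-Sz)) * (((y₁ - u₁) - (yV - uV)) * ((y₂ + u₂) - (yV + uV)) + ((y₂ - u₂) - (yV - uV)) * ((y₁ + u₁) - (yV + uV)))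
        + (1/2 * Z₁ * Z₃ + 3/4 * (Z₁ ^ 2 + Z₃ ^ 2) + 1/2 * (-Sz)) * (((y₁ - u₁) - (yV - uV)) * ((y₃ + u₃) - (yV + uV)) + ((y₃ - u₃) - (yV - uV)) * ((y₁ + u₁) - (yV + uV)))
        + (1/2 * Z₁ * Z₄ + 3/4 * (Z₁ ^ 2 + Z₄ ^ 2) + 1/2 * (-Sz)) * (((y₁ - u₁) - (yV - uV)) * ((y₄ + u₄) - (yV + uV)) + ((y₄ - u₄) - (yV - uV)) * ((y₁ + u₁) - (yV + uV)))
        + (1/2 * Z₁ * Z₅ + 3/4 * (Z₁ ^ 2 + Z₅ ^ 2) + 1/2 * (-Sz)) * (((y₁ - u₁) - (yV - uV)) * ((yV + uV) - (y₅ + u₅)) + ((yV - uV) - (y₅ - u₅)) * ((y₁ + u₁) - (yV + uV)))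
        + (1/2 * Z₁ * Z₆ + 3/4 * (Z₁ ^ 2 + Z₆ ^ 2) + 1/2 * (-Sz)) * (((y₁ - u₁) - (yV - uV)) * ((yV + uV) - (y₆ + u₆)) + ((yV - uV) - (y₆ - u₆)) * ((y₁ + u₁) - (yV + uV)))
        + (1/2 * Z₂ ^ 2 + 1/4 * (-Sz)) * (((y₂ - u₂) - (yV - uV)) * ((y₂ + u₂) - (yV + uV)))
        + (1/2 * Z₂ * Z₃ + 3/4 * (Z₂ ^ 2 + Z₃ ^ 2) + 1/2 * (-Sz)) * (((y₂ - u₂) - (yV - uV)) * ((y₃ + u₃) - (yV + uV)) + ((y₃ - u₃) - (yV - uV)) * ((y₂ + u₂) - (yV + uV)))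
        + (1/2 * Z₂ * Z₄ + 3/4 * (Z₂ ^ 2 + Z₄ ^ 2) + 1/2 * (-Sz)) * (((y₂ - u₂) - (yV - uV)) * ((y₄ + u₄) - (yV + uV)) + ((y₄ - u₄) - (yV - uV)) * ((y₂ + u₂) - (yV + uV)))
        + (1/2 * Z₂ * Z₅ + 3/4 * (Z₂ ^ 2 + Z₅ ^ 2) + 1/2 * (-Sz)) * (((y₂ - u₂) - (yV - uV)) * ((yV + uV) - (y₅ + u₅)) + ((yV - uV) - (y₅ - u₅)) * ((y₂ + u₂) - (yV + uV)))
        + (1/2 * Z₂ * Z₆ + 3/4 * (Z₂ ^ 2 + Z₆ ^ 2) + 1/2 * (-Sz)) * (((y₂ - u₂) - (yV - uV)) * ((yV + uV) - (y₆ + u₆)) + ((yV - uV) - (y₆ - u₆)) * ((y₂ + u₂) - (yV + uV)))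
        + (1/2 * Z₃ ^ 2 + 1/4 * (-Sz)) * (((y₃ - u₃) - (yV - uV)) * ((y₃ + u₃) - (yV + uV)))
        + (1/2 * Z₃ * Z₄ + 3/4 * (Z₃ ^ 2 + Z₄ ^ 2) + 1/2 * (-Sz)) * (((y₃ - u₃) - (yV - uV)) * ((y₄ + u₄) - (yV + uV)) + ((y₄ - u₄) - (yV - uV)) * ((y₃ + u₃) - (yV + uV)))
        + (1/2 * Z₃ * Z₅ + 3/4 * (Z₃ ^ 2 + Z₅ ^ 2) + 1/2 * (-Sz)) * (((y₃ - u₃) - (yV - uV)) * ((yV + uV) - (y₅ + u₅)) + ((yV - uV) - (y₅ - u₅)) * ((y₃ + u₃) - (yV + uV)))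
        + (1/2 * Z₃ * Z₆ + 3/4 * (Z₃ ^ 2 + Z₆ ^ 2) + 1/2 * (-Sz)) * (((y₃ - u₃) - (yV - uV)) * ((yV + uV) - (y₆ + u₆)) + ((yV - uV) - (y₆ - u₆)) * ((y₃ + u₃) - (yV + uV)))
        + (1/2 * Z₄ ^ 2 + 1/4 * (-Sz)) * (((y₄ - u₄) - (yV - uV)) * ((y₄ + u₄) - (yV + uV)))
        + (1/2 * Z₄ * Z₅ + 3/4 * (Z₄ ^ 2 + Z₅ ^ 2) + 1/2 * (-Sz)) * (((y₄ - u₄) - (yV - uV)) * ((yV + uV) - (y₅ + u₅)) + ((yV - uV) - (y₅ - u₅)) * ((y₄ + u₄) - (yV + uV)))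
        + (1/2 * Z₄ * Z₆ + 3/4 * (Z₄ ^ 2 + Z₆ ^ 2) + 1/2 * (-Sz)) * (((y₄ - u₄) - (yV - uV)) * ((yV + uV) - (y₆ + u₆)) + ((yV - uV) - (y₆ - u₆)) * ((y₄ + u₄) - (yV + uV)))
        + (7/2 * Z₅ ^ 2 + 3/4 * (-Sz)) * (((yV - uV) - (y₅ - u₅)) * ((yV + uV) - (y₅ + u₅)))
        + (1/2 * Z₅ * Z₆ + 3/4 * (Z₅ ^ 2 + Z₆ ^ 2) + 1/2 * (-Sz)) * (((yV - uV) - (y₅ - u₅)) * ((yV + uV) - (y₆ + u₆)) + ((yV - uV) - (y₆ - u₆)) * ((yV + uV) - (y₅ + u₅)))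
        + (7/2 * Z₆ ^ 2 + 3/4 * (-Sz)) * (((yV - uV) - (y₆ - u₆)) * ((yV + uV) - (y₆ + u₆)))) := by
    simp only [Sz4, Sy2z2, Syz, Sz, Sy, Z₆, Z₅, Z₄, Z₃, Z₂, Z₁, Y₆, Y₅, Y₄, Y₃, Y₂, Y₁, ub, yb]
    ring
  rw [key]
  exact format42_vertexSum_nonneg Z₁ Z₂ Z₃ Z₄ Z₅ Z₆ (-Sz)
    ((y₁ + u₁) - (yV + uV)) ((y₁ - u₁) - (yV - uV)) ((y₂ + u₂) - (yV + uV)) ((y₂ - u₂) - (yV - uV)) ((y₃ + u₃) - (yV + uV)) ((y₃ - u₃) - (yV - uV)) ((y₄ + u₄) - (yV + uV)) ((y₄ - u₄) - (yV - uV)) ((yV + uV) - (y₅ + u₅)) ((yV - uV) - (y₅ - u₅)) ((yV + uV) - (y₆ + u₆)) ((yV - uV) - (y₆ - u₆))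
    hD gp₁ gq₁ gp₂ gq₂ gp₃ gq₃ gp₄ gq₄ gp₅ gq₅ gp₆ gq₆

end Summit.HodgeConjecture.HodgeConjecture.WeilClassTestVertexForm42
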